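import Mathlib
import HarnessLib
import Summits.NavierStokesRegularity.NavierStokesRegularity.Theorems.TypeILiouvilleLambTailPolynomial
import Literature.Analysis.FluidPDE.LocalBiotSavartLogLocalEnergy

/-!
# TypeILiouvilleLambTailLogDial — crux (L) stmt-NavierStokesRegularity-10661 `TypeIliouvilleL`:
# THE LOG-LIPSCHITZ GRADIENT DIAL ON PRINT'S CLASS — VORTICITY FADING FASTER THAN THE TYPE-I RATE IS TRIVIAL
# (part 9 of `TypeILiouvilleLambTail`; unconditional)

Helper for stmt-NavierStokesRegularity-10661 (`--supports`); theorems only, no definitions, no named-fact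
hypotheses; closes no item; Navier–Stokes regularity is NOT proved here (leafhand seat of the EulerZoomLiouville route).

Class P, `ω = curl v`, vortex commutator `f = Dv[ω] − Dω[v] = curl(v × ω)` as in parts 1–8.  Part 8's dial had the RATE
`Ω^{1/4}` (Poisson + Landau; strata `β > 4` / `p > 5`).  Here the conversion uses the tree's Beale–Kato–Majda logarithmic
potential estimate WITH LOCAL ENERGY (`Literature.Analysis.FluidPDE.exists_opNorm_fderiv_le_log_local`, Majda–Bertozzi
Prop. 3.8 / (3.87), no decay at infinity), rescaled to an arbitrary ball on the bounded class:

* `classP_norm_fderiv_le_log` — ★ **THE LOG-LIPSCHITZ DIAL**: with `‖v‖ ≤ K`, for every slice `τ < 0`, every `½`-Hölder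
  constant `H` and sup bound `Ω` of `ω(τ,·)`, every `r > 0`, `0 < δ ≤ 1`:
  `‖∇v(τ,x)‖ ≤ C ((r^{1/2} H + Ω) δ^{1/2} + Ω log(1/δ) + K/r)` (unit estimate applied to `y ↦ v(τ, x + r y)`).
* `const_of_vorticity_decay_gt_one` — ★★★ **VORTICITY FADING FASTER THAN THE TYPE-I RATE ⟹ ONE CONSTANT VECTOR**:
  a class-P flow with `‖ω(τ,x)‖ ≤ M (−τ)^{−β}` on `(−∞,0) × ℝ³` for some `β > 1` is constant (scales
  `r = (1−τ)^{β}`, `δ = (1−τ)^{−2β}` give the gradient majorant `≲ (1−τ)^{−β} log(1−τ) ≲ (1−τ)^{−(β+1)/2}`,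
  integrable).  `β = 1` is EXACTLY the scale-invariant (Type-I) vorticity rate `‖ω(t)‖ ≲ (−t)^{−1}` (`M ↦ λ^{2−2β} M`
  under `v ↦ λv(λ²t, λx)`): on the vorticity-decay axis the residual of (L) now sits AT the Type-I rate and slower.
* `const_of_commutator_decay_gt_two`, `const_of_lambCurl_decay_gt_two` — ★★ `‖curl(v × ω)(τ,x)‖ ≤ A (−τ)^{−p}` for
  some `p > 2` ⟹ constant (`p = 2` is the scale-invariant Lamb-curl rate).

HONEST LABEL: classical potential estimates; nothing here proves a registered stub, (L), or NS regularity; rung 0.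
[cite: MajdaBertozziCUP2002, §3.3 Prop. 3.8, (3.87)] [cite: KochNadirashviliSereginSverak2009, §4 (i), Lemma 6.1 (arXiv:0709.3599)]
-/

noncomputable section
open MeasureTheory Filter Set Function Metric
open scoped Topology ENNReal NNReal RealInnerProductSpace Laplacian ContDiff
open Literature.Analysis Literature.Analysis.FluidPDE Literature.Analysis.UnboundedOperators
set_option linter.dupNamespace false
namespace Summit.NavierStokesRegularity.NavierStokesRegularity.Theorems.TypeILiouvilleLambTail

/-! ## §1 Rescaling a slice: `y ↦ u (x₀ + r y)` -/

/-- Chain rule for the affine rescaling: `D(u(x₀ + r ·))(y) = r · Du(x₀ + r y)` (junk-compatible; adapted from the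
tree's `curl_comp_add_smul`, LeiZhang2011StreamRescaling). [folklore] -/
theorem fderiv_comp_add_smul (u : EuclideanSpace ℝ (Fin 3) → EuclideanSpace ℝ (Fin 3))
    (x₀ : EuclideanSpace ℝ (Fin 3)) (r : ℝ) (y : EuclideanSpace ℝ (Fin 3)) :
    fderiv ℝ (fun z => u (x₀ + r • z)) y = r • fderiv ℝ u (x₀ + r • y) := by
  have h2 := fderiv_comp_smul (𝕜 := ℝ) (f := fun z => u (x₀ + z)) (x := y) r
  simp only [fderiv_comp_add_left] at h2
  exact h2

/-- Curl of the affine rescaling: `curl (u(x₀ + r ·))(y) = r · (curl u)(x₀ + r y)`. [folklore] -/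
theorem curl_comp_add_smul' (u : EuclideanSpace ℝ (Fin 3) → EuclideanSpace ℝ (Fin 3))
    (x₀ : EuclideanSpace ℝ (Fin 3)) (r : ℝ) (y : EuclideanSpace ℝ (Fin 3)) :
    curl (fun z => u (x₀ + r • z)) y = r • curl u (x₀ + r • y) := by
  show curlCLM (fderiv ℝ (fun z => u (x₀ + r • z)) y) = r • curlCLM (fderiv ℝ u (x₀ + r • y))
  rw [fderiv_comp_add_smul, map_smul]

/-- The affine rescaling of a divergence-free field is divergence free. [folklore] -/
theorem isDivFree_comp_add_smul {u : EuclideanSpace ℝ (Fin 3) → EuclideanSpace ℝ (Fin 3)}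
    (hu : VectorCalculus.IsDivFree u) (x₀ : EuclideanSpace ℝ (Fin 3)) (r : ℝ) :
    VectorCalculus.IsDivFree (fun z => u (x₀ + r • z)) := by
  intro y
  have hy := hu (x₀ + r • y)
  simp only [VectorCalculus.divergence] at hy ⊢
  rw [fderiv_comp_add_smul, ContinuousLinearMap.toLinearMap_smul, map_smul, hy, smul_zero]

/-! ## §2 The log-Lipschitz gradient dial on print's class -/

/-- ★ **THE LOG-LIPSCHITZ DIAL (class P).**  With `‖v‖ ≤ K`: there is `C ≥ 0` such that for every slice `τ < 0`, all
`H, Ω ≥ 0` with `‖ω(τ,y) − ω(τ,y')‖ ≤ H ‖y − y'‖^{1/2}` and `‖ω(τ,y)‖ ≤ Ω`, every `r > 0` and `0 < δ ≤ 1`: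
`‖∇v(τ,x)‖ ≤ C ((r^{1/2} H + Ω) δ^{1/2} + Ω log(1/δ) + K/r)`.  Proof: the tree's local-energy form of
Majda–Bertozzi (3.87) applied at the origin to the rescaled slice `y ↦ v(τ, x + r y)` (smooth, divergence free,
bounded by `K`, vorticity `r ω(τ, x + r y)` with sup `rΩ` and `½`-Hölder constant `r^{3/2} H`), then division by `r`.
[cite: MajdaBertozziCUP2002, §3.3 Prop. 3.8, (3.87)] [cite: KochNadirashviliSereginSverak2009, §4 (arXiv:0709.3599)] -/
theorem classP_norm_fderiv_le_log
    {v : ℝ → EuclideanSpace ℝ (Fin 3) → EuclideanSpace ℝ (Fin 3)}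
    (hc : ContinuousOn (uncurry v) (Iio 0 ×ˢ univ))
    {K : ℝ} (hKb : ∀ t < 0, ∀ x, ‖v t x‖ ≤ K)
    (hd : ∀ t < 0, IsWeaklyDivFree (v t))
    (hm : ∀ s t : ℝ, s < t → t < 0 → ∀ x,
      v t x = heatExtension (v s) (t - s) x - oseenDuhamel 1 s v v t x) :
    ∃ C : ℝ, 0 ≤ C ∧ ∀ τ < 0, ∀ H Ω : ℝ, 0 ≤ H → 0 ≤ Ω →
      (∀ y y', ‖curl (v τ) y - curl (v τ) y'‖ ≤ H * ‖y - y'‖ ^ (1 / 2 : ℝ)) →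
      (∀ y, ‖curl (v τ) y‖ ≤ Ω) →
      ∀ r : ℝ, 0 < r → ∀ δ : ℝ, 0 < δ → δ ≤ 1 → ∀ x : EuclideanSpace ℝ (Fin 3),
        ‖fderiv ℝ (v τ) x‖ ≤ C * ((r ^ (1 / 2 : ℝ) * H + Ω) * δ ^ (1 / 2 : ℝ) + Ω * Real.log (1 / δ) + K / r) := by
  have hK0 : 0 ≤ K := (norm_nonneg _).trans (hKb (-1) (by norm_num) 0)
  obtain ⟨hsm', -⟩ := smooth_and_bounds_of_bounded_ancient_oseenMild hc hd hm hKb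
  have hsm : IsSmoothSpaceTimeOn (Iio 0) v := hsm'
  obtain ⟨C, hC0, hCv⟩ := exists_opNorm_fderiv_le_log_local
  set V₃ : ℝ := (volume : Measure (EuclideanSpace ℝ (Fin 3))).real (ball 0 3) with hV₃
  have hV₃0 : 0 ≤ V₃ := measureReal_nonneg
  refine ⟨C * (1 + Real.sqrt V₃), by positivity, fun τ hτ H Ω hH0 hΩ0 hH hΩ r hr δ hδ hδ1 x₀ => ?_⟩
  have hvs : ContDiff ℝ ∞ (v τ) := hsm.contDiff_slice (mem_Iio.2 hτ)
  have hdiv : VectorCalculus.IsDivFree (v τ) := (hd τ hτ).isDivFree_of_contDiff (hvs.of_le (by norm_cast))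
  -- the rescaled slice
  set u : EuclideanSpace ℝ (Fin 3) → EuclideanSpace ℝ (Fin 3) := fun z => v τ (x₀ + r • z) with hu_def
  have hu : ContDiff ℝ ∞ u := hvs.comp (contDiff_const.add (contDiff_id.const_smul r))
  have hudiv : VectorCalculus.IsDivFree u := isDivFree_comp_add_smul hdiv x₀ r
  have hcurl : ∀ y, curl u y = r • curl (v τ) (x₀ + r • y) := fun y => curl_comp_add_smul' (v τ) x₀ r y
  have hΩu : ∀ y, ‖curl u y‖ ≤ (r * Ω).toNNReal := fun y => by
    rw [hcurl y, norm_smul, Real.norm_of_nonneg hr.le, Real.coe_toNNReal _ (by positivity)]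
    exact mul_le_mul_of_nonneg_left (hΩ _) hr.le
  have hHu : HolderWith (r * r ^ (1 / 2 : ℝ) * H).toNNReal (1 / 2) (curl u) := by
    refine FunctionSpaces.holderWith_of_dist_le fun y y' => ?_
    rw [Real.coe_toNNReal _ (by positivity), dist_eq_norm, dist_eq_norm, hcurl y, hcurl y', ← smul_sub, norm_smul,
      Real.norm_of_nonneg hr.le]
    have hexp : (((1 / 2 : ℝ≥0) : ℝ)) = 1 / 2 := by norm_num
    rw [hexp]
    have h1 := hH (x₀ + r • y) (x₀ + r • y')
    have hdist : ‖x₀ + r • y - (x₀ + r • y')‖ = r * ‖y - y'‖ := by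
      rw [show x₀ + r • y - (x₀ + r • y') = r • (y - y') by rw [smul_sub]; abel, norm_smul,
        Real.norm_of_nonneg hr.le]
    rw [hdist, Real.mul_rpow hr.le (norm_nonneg _)] at h1
    calc r * ‖curl (v τ) (x₀ + r • y) - curl (v τ) (x₀ + r • y')‖
        ≤ r * (H * (r ^ (1 / 2 : ℝ) * ‖y - y'‖ ^ (1 / 2 : ℝ))) := mul_le_mul_of_nonneg_left h1 hr.le
      _ = r * r ^ (1 / 2 : ℝ) * H * ‖y - y'‖ ^ (1 / 2 : ℝ) := by ring
  -- the local energy of the rescaled slice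
  have hE : Real.sqrt (∫ y in ball (0 : EuclideanSpace ℝ (Fin 3)) 3, ‖u y‖ ^ 2) ≤ K * Real.sqrt V₃ := by
    have hb : ‖∫ y in ball (0 : EuclideanSpace ℝ (Fin 3)) 3, ‖u y‖ ^ 2‖ ≤ K ^ 2 * V₃ := by
      refine norm_setIntegral_le_of_norm_le_const measure_ball_lt_top fun y _ => ?_
      rw [Real.norm_of_nonneg (sq_nonneg _)]
      exact pow_le_pow_left₀ (norm_nonneg _) (hKb τ hτ _) 2
    calc Real.sqrt (∫ y in ball (0 : EuclideanSpace ℝ (Fin 3)) 3, ‖u y‖ ^ 2) ≤ Real.sqrt (K ^ 2 * V₃) :=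
          Real.sqrt_le_sqrt ((le_abs_self _).trans ((Real.norm_eq_abs _).symm.le.trans hb))
      _ = K * Real.sqrt V₃ := by rw [Real.sqrt_mul (sq_nonneg _), Real.sqrt_sq hK0]
  -- the unit-scale estimate at the origin
  have h := hCv u hu hudiv _ _ hHu hΩu δ hδ hδ1 0
  rw [Real.coe_toNNReal _ (by positivity), Real.coe_toNNReal _ (by positivity)] at h
  have hD : fderiv ℝ u 0 = r • fderiv ℝ (v τ) x₀ := by
    rw [hu_def, fderiv_comp_add_smul, smul_zero, add_zero]
  rw [hD, norm_smul, Real.norm_of_nonneg hr.le] at h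
  have hlog0 : 0 ≤ Real.log (1 / δ) := Real.log_nonneg ((one_le_div hδ).2 hδ1)
  have hd0 : 0 ≤ δ ^ (1 / 2 : ℝ) := Real.rpow_nonneg hδ.le _
  have hr2 : 0 ≤ r ^ (1 / 2 : ℝ) := Real.rpow_nonneg hr.le _
  have key : r * ‖fderiv ℝ (v τ) x₀‖ ≤
      r * (C * (1 + Real.sqrt V₃) * ((r ^ (1 / 2 : ℝ) * H + Ω) * δ ^ (1 / 2 : ℝ) + Ω * Real.log (1 / δ) + K / r)) := by
    calc r * ‖fderiv ℝ (v τ) x₀‖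
        ≤ C * ((r * r ^ (1 / 2 : ℝ) * H + r * Ω) * δ ^ (1 / 2 : ℝ) + r * Ω * Real.log (1 / δ) + K * Real.sqrt V₃) := by
          refine h.trans (mul_le_mul_of_nonneg_left ?_ hC0)
          exact add_le_add le_rfl hE
      _ = r * (C * (((r ^ (1 / 2 : ℝ) * H + Ω) * δ ^ (1 / 2 : ℝ) + Ω * Real.log (1 / δ)) + Real.sqrt V₃ * (K / r))) := by
          field_simp
      _ ≤ r * (C * (1 + Real.sqrt V₃) *
            ((r ^ (1 / 2 : ℝ) * H + Ω) * δ ^ (1 / 2 : ℝ) + Ω * Real.log (1 / δ) + K / r)) := by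
          refine mul_le_mul_of_nonneg_left ?_ hr.le
          have hS0 : 0 ≤ Real.sqrt V₃ := Real.sqrt_nonneg _
          have hY0 : 0 ≤ (r ^ (1 / 2 : ℝ) * H + Ω) * δ ^ (1 / 2 : ℝ) + Ω * Real.log (1 / δ) := by positivity
          have hZ0 : 0 ≤ K / r := by positivity
          nlinarith [mul_nonneg hC0 hS0, mul_nonneg (mul_nonneg hC0 hS0) hY0, mul_nonneg hC0 hZ0,
            mul_nonneg hC0 hY0]
  exact le_of_mul_le_mul_left key hr

/-- **The `½`-Hölder constant of a fading vorticity slice (class P).**  With `D₂` the constant of part 8's Landau dial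
(`classP_norm_fderiv_curl_le_of_curl_le`): if `‖ω(τ,·)‖ ≤ Ω ≤ Ω'` then
`‖ω(τ,y) − ω(τ,y')‖ ≤ (2Ω(4Ω' + D₂))^{1/2} ‖y − y'‖^{1/2}` (interpolation of the oscillation `2Ω` with the
Lipschitz constant `4Ω + D₂ ≤ 4Ω' + D₂` given by the Landau dial at `s = 1`). [folklore] -/
theorem classP_holderHalf_curl_of_curl_le
    {v : ℝ → EuclideanSpace ℝ (Fin 3) → EuclideanSpace ℝ (Fin 3)}
    (hc : ContinuousOn (uncurry v) (Iio 0 ×ˢ univ))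
    (hK : ∃ K : ℝ, ∀ t < 0, ∀ x, ‖v t x‖ ≤ K)
    (hd : ∀ t < 0, IsWeaklyDivFree (v t))
    (hm : ∀ s t : ℝ, s < t → t < 0 → ∀ x,
      v t x = heatExtension (v s) (t - s) x - oseenDuhamel 1 s v v t x) :
    ∃ D₂ : ℝ, 0 ≤ D₂ ∧ ∀ τ < 0, ∀ Ω Ω' : ℝ, 0 ≤ Ω → Ω ≤ Ω' → (∀ y, ‖curl (v τ) y‖ ≤ Ω) →
      ∀ y y', ‖curl (v τ) y - curl (v τ) y'‖ ≤
        Real.sqrt (2 * Ω * (4 * Ω' + D₂)) * ‖y - y'‖ ^ (1 / 2 : ℝ) := by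
  obtain ⟨K, hKb⟩ := hK
  obtain ⟨hsm', -⟩ := smooth_and_bounds_of_bounded_ancient_oseenMild hc hd hm hKb
  have hsm : IsSmoothSpaceTimeOn (Iio 0) v := hsm'
  have hvort : IsSmoothSpaceTimeOn (Iio 0) (vorticity v) := isSmoothSpaceTimeOn_vorticity_Iio hsm
  obtain ⟨D₂, hD₂0, hL⟩ := classP_norm_fderiv_curl_le_of_curl_le hc ⟨K, hKb⟩ hd hm
  refine ⟨D₂, hD₂0, fun τ hτ Ω Ω' hΩ0 hΩΩ' hΩ y y' => ?_⟩
  have hf : ContDiff ℝ ∞ (curl (v τ)) := hvort.contDiff_slice (mem_Iio.2 hτ)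
  -- Lipschitz bound from the Landau dial at `s = 1`
  have hLip : ∀ z, ‖fderiv ℝ (curl (v τ)) z‖ ≤ 4 * Ω' + D₂ := fun z => by
    have h := hL τ hτ Ω hΩ 1 one_pos z
    rw [div_one, one_mul] at h
    linarith
  have h1 : ‖curl (v τ) y - curl (v τ) y'‖ ≤ (4 * Ω' + D₂) * ‖y - y'‖ :=
    (convex_univ (𝕜 := ℝ)).norm_image_sub_le_of_norm_fderiv_le
      (fun z _ => (hf.differentiable (by simp)) z) (fun z _ => hLip z) (mem_univ y') (mem_univ y)
  have h2 : ‖curl (v τ) y - curl (v τ) y'‖ ≤ 2 * Ω := (norm_sub_le _ _).trans (by linarith [hΩ y, hΩ y'])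
  have hX0 : 0 ≤ ‖curl (v τ) y - curl (v τ) y'‖ := norm_nonneg _
  have hsq : ‖curl (v τ) y - curl (v τ) y'‖ ^ 2 ≤ 2 * Ω * (4 * Ω' + D₂) * ‖y - y'‖ := by
    rw [sq]
    calc ‖curl (v τ) y - curl (v τ) y'‖ * ‖curl (v τ) y - curl (v τ) y'‖
        ≤ (2 * Ω) * ((4 * Ω' + D₂) * ‖y - y'‖) := mul_le_mul h2 h1 hX0 (by positivity)
      _ = 2 * Ω * (4 * Ω' + D₂) * ‖y - y'‖ := by ring
  have h3 : ‖curl (v τ) y - curl (v τ) y'‖ ≤ Real.sqrt (2 * Ω * (4 * Ω' + D₂) * ‖y - y'‖) :=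
    Real.le_sqrt_of_sq_le hsq
  rw [Real.sqrt_mul (by nlinarith [hΩ0, hΩΩ', hD₂0]), Real.sqrt_eq_rpow ‖y - y'‖] at h3
  exact h3

/-! ## §3 Vorticity fading faster than the Type-I rate ⟹ one constant vector -/

/-- **Shifted form.**  A class-P flow with `‖ω(τ,x)‖ ≤ M (1 − τ)^{−β}` on `(−∞,0) × ℝ³` for some `β > 1` is one constant
vector: the log-Lipschitz dial at `r = (1−τ)^{β}`, `δ = (1−τ)^{−2β}` and `log(1−τ) ≤ (1−τ)^{ε}/ε`, `ε = (β−1)/2`,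
give the integrable gradient majorant `A₁ (1−τ)^{−(β+1)/2}`; then
`TypeILiouvilleStrainLedger.const_of_integrable_gradient_tail`. [cite: MajdaBertozziCUP2002, §3.3 Prop. 3.8, (3.87)]
[cite: MajdaBertozziCUP2002, eq. (3.80)] [cite: KochNadirashviliSereginSverak2009, §4 (i) (arXiv:0709.3599)] -/
theorem const_of_vorticity_decay_gt_one_shifted
    {v : ℝ → EuclideanSpace ℝ (Fin 3) → EuclideanSpace ℝ (Fin 3)}
    (hc : ContinuousOn (uncurry v) (Iio 0 ×ˢ univ))
    (hK : ∃ K : ℝ, ∀ t < 0, ∀ x, ‖v t x‖ ≤ K)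
    (hd : ∀ t < 0, IsWeaklyDivFree (v t))
    (hm : ∀ s t : ℝ, s < t → t < 0 → ∀ x,
      v t x = heatExtension (v s) (t - s) x - oseenDuhamel 1 s v v t x)
    {β M : ℝ} (hβ : 1 < β)
    (hω : ∀ τ < 0, ∀ x : EuclideanSpace ℝ (Fin 3), ‖curl (v τ) x‖ ≤ M * (1 - τ) ^ (-β)) :
    ∃ b : EuclideanSpace ℝ (Fin 3), ∀ t < 0, ∀ x, v t x = b := by
  obtain ⟨K, hKb⟩ := hK
  have hK0 : 0 ≤ K := (norm_nonneg _).trans (hKb (-1) (by norm_num) 0)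
  have hM0 : 0 ≤ M := by
    have h := (norm_nonneg _).trans (hω (-1) (by norm_num) 0)
    exact nonneg_of_mul_nonneg_left h (Real.rpow_pos_of_pos (by norm_num) _)
  obtain ⟨D₂, hD₂0, hH⟩ := classP_holderHalf_curl_of_curl_le hc ⟨K, hKb⟩ hd hm
  obtain ⟨C, hC0, hLog⟩ := classP_norm_fderiv_le_log hc hKb hd hm
  set ε : ℝ := (β - 1) / 2 with hε
  have hε0 : 0 < ε := by rw [hε]; linarith
  set H₀ : ℝ := Real.sqrt (2 * M * (4 * M + D₂)) with hH₀
  have hH₀0 : 0 ≤ H₀ := Real.sqrt_nonneg _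
  -- the gradient majorant
  set A₁ : ℝ := C * (H₀ + M + K + M * (2 * β) / ε) with hA₁
  set g : ℝ → ℝ := fun τ => A₁ * (max (1 - τ) 1) ^ (-((β + 1) / 2)) with hg_def
  have hgc : Continuous g := continuous_const.mul (Continuous.rpow_const (by fun_prop) fun τ =>
    Or.inl (lt_of_lt_of_le one_pos (le_max_right _ _)).ne')
  have hg_eq : ∀ τ < 0, g τ = A₁ * (1 - τ) ^ (-((β + 1) / 2)) := fun τ hτ => by
    simp [hg_def, max_eq_left (by linarith : (1 : ℝ) ≤ 1 - τ)]
  have hgrad : ∀ τ < 0, ∀ x : EuclideanSpace ℝ (Fin 3), ‖fderiv ℝ (v τ) x‖ ≤ g τ := by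
    intro τ hτ x
    have h1τ : 1 < 1 - τ := by linarith
    have h1τ0 : 0 < 1 - τ := by linarith
    set Ω : ℝ := M * (1 - τ) ^ (-β) with hΩ
    have hΩ0 : 0 ≤ Ω := mul_nonneg hM0 (Real.rpow_nonneg h1τ0.le _)
    have hpow1 : (1 - τ) ^ (-β) ≤ 1 := Real.rpow_le_one_of_one_le_of_nonpos h1τ.le (by linarith)
    have hΩM : Ω ≤ M := (mul_le_mul_of_nonneg_left hpow1 hM0).trans (mul_one M).le
    -- Hölder constant `H = √(2Ω(4M+D₂)) = H₀ (1-τ)^{-β/2}`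
    have hHτ := hH τ hτ Ω M hΩ0 hΩM (hω τ hτ)
    have hHeq : Real.sqrt (2 * Ω * (4 * M + D₂)) = H₀ * (1 - τ) ^ (-(β / 2)) := by
      rw [hH₀, hΩ, show 2 * (M * (1 - τ) ^ (-β)) * (4 * M + D₂) = (1 - τ) ^ (-β) * (2 * M * (4 * M + D₂)) by ring,
        Real.sqrt_mul (Real.rpow_nonneg h1τ0.le _), Real.sqrt_eq_rpow, ← Real.rpow_mul h1τ0.le, mul_comm]
      congr 2; ring
    rw [hHeq] at hHτ
    have hr : 0 < (1 - τ) ^ β := Real.rpow_pos_of_pos h1τ0 _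
    have hδ : 0 < (1 - τ) ^ (-(2 * β)) := Real.rpow_pos_of_pos h1τ0 _
    have hδ1 : (1 - τ) ^ (-(2 * β)) ≤ 1 := Real.rpow_le_one_of_one_le_of_nonpos h1τ.le (by linarith)
    have h := hLog τ hτ (H₀ * (1 - τ) ^ (-(β / 2))) Ω (by positivity) hΩ0 hHτ (fun y => hω τ hτ y)
      _ hr _ hδ hδ1 x
    have e1 : ((1 - τ) ^ β) ^ (1 / 2 : ℝ) * (H₀ * (1 - τ) ^ (-(β / 2))) = H₀ := by
      rw [← Real.rpow_mul h1τ0.le, show (1 - τ) ^ (β * (1 / 2)) * (H₀ * (1 - τ) ^ (-(β / 2))) =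
        H₀ * ((1 - τ) ^ (β * (1 / 2)) * (1 - τ) ^ (-(β / 2))) by ring, ← Real.rpow_add h1τ0]
      rw [show β * (1 / 2) + -(β / 2) = 0 by ring, Real.rpow_zero, mul_one]
    have e2 : ((1 - τ) ^ (-(2 * β))) ^ (1 / 2 : ℝ) = (1 - τ) ^ (-β) := by
      rw [← Real.rpow_mul h1τ0.le]; congr 1; ring
    have e3 : Real.log (1 / (1 - τ) ^ (-(2 * β))) = 2 * β * Real.log (1 - τ) := by
      rw [one_div, ← Real.rpow_neg h1τ0.le, neg_neg, Real.log_rpow h1τ0]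
    have e4 : K / (1 - τ) ^ β = K * (1 - τ) ^ (-β) := by rw [Real.rpow_neg h1τ0.le, div_eq_mul_inv]
    rw [e1, e2, e3, e4] at h
    -- `log (1-τ) ≤ (1-τ)^ε/ε`, `(1-τ)^{-β} ≤ 1`, `1 ≤ (1-τ)^ε`
    have hlog : Real.log (1 - τ) ≤ (1 - τ) ^ ε / ε := Real.log_le_rpow_div h1τ0.le hε0
    have hlog0 : 0 ≤ Real.log (1 - τ) := Real.log_nonneg h1τ.le
    have hpε : 1 ≤ (1 - τ) ^ ε := Real.one_le_rpow h1τ.le hε0.le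
    have hpow0 : 0 ≤ (1 - τ) ^ (-β) := Real.rpow_nonneg h1τ0.le _
    have hmain : (H₀ + Ω) * (1 - τ) ^ (-β) + Ω * (2 * β * Real.log (1 - τ)) + K * (1 - τ) ^ (-β) ≤
        (H₀ + M + K + M * (2 * β) / ε) * ((1 - τ) ^ ε * (1 - τ) ^ (-β)) := by
      have i1 : (H₀ + Ω) * (1 - τ) ^ (-β) ≤ (H₀ + M) * ((1 - τ) ^ ε * (1 - τ) ^ (-β)) := by
        have : (H₀ + Ω) * (1 - τ) ^ (-β) ≤ (H₀ + M) * (1 - τ) ^ (-β) :=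
          mul_le_mul_of_nonneg_right (by linarith) hpow0
        nlinarith [mul_nonneg (by positivity : (0 : ℝ) ≤ H₀ + M) hpow0]
      have i2 : Ω * (2 * β * Real.log (1 - τ)) ≤ M * (2 * β) / ε * ((1 - τ) ^ ε * (1 - τ) ^ (-β)) := by
        have hβ0 : 0 ≤ 2 * β := by linarith
        calc Ω * (2 * β * Real.log (1 - τ)) = M * (2 * β) * (Real.log (1 - τ) * (1 - τ) ^ (-β)) := by
              rw [hΩ]; ring
          _ ≤ M * (2 * β) * ((1 - τ) ^ ε / ε * (1 - τ) ^ (-β)) :=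
              mul_le_mul_of_nonneg_left (mul_le_mul_of_nonneg_right hlog hpow0) (by positivity)
          _ = M * (2 * β) / ε * ((1 - τ) ^ ε * (1 - τ) ^ (-β)) := by field_simp
      have i3 : K * (1 - τ) ^ (-β) ≤ K * ((1 - τ) ^ ε * (1 - τ) ^ (-β)) := by
        nlinarith [mul_nonneg hK0 hpow0]
      nlinarith [i1, i2, i3]
    have hexp : (1 - τ) ^ ε * (1 - τ) ^ (-β) = (1 - τ) ^ (-((β + 1) / 2)) := by
      rw [← Real.rpow_add h1τ0, hε]; congr 1; ring
    rw [hg_eq τ hτ, hA₁]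
    calc ‖fderiv ℝ (v τ) x‖ ≤ C * ((H₀ + Ω) * (1 - τ) ^ (-β) + Ω * (2 * β * Real.log (1 - τ)) + K * (1 - τ) ^ (-β)) := h
      _ ≤ C * ((H₀ + M + K + M * (2 * β) / ε) * ((1 - τ) ^ ε * (1 - τ) ^ (-β))) :=
          mul_le_mul_of_nonneg_left hmain hC0
      _ = C * (H₀ + M + K + M * (2 * β) / ε) * (1 - τ) ^ (-((β + 1) / 2)) := by rw [hexp]; ring
  have hint : IntegrableOn g (Iic (-1)) := by
    have h : IntegrableOn (fun τ : ℝ => A₁ * (1 - τ) ^ (-((β + 1) / 2))) (Iic (-1)) :=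
      (integrableOn_one_sub_rpow_neg_Iic (q := (β + 1) / 2) (by linarith)).const_mul A₁
    exact IntegrableOn.congr_fun h (fun τ hτ => (hg_eq τ (by
      have : τ ≤ -1 := mem_Iic.1 hτ
      linarith)).symm) measurableSet_Iic
  exact TypeILiouvilleStrainLedger.const_of_integrable_gradient_tail hc ⟨K, hKb⟩ hd hm hgc hgrad hint

/-- ★★★ **VORTICITY FADING FASTER THAN THE TYPE-I RATE ⟹ ONE CONSTANT VECTOR (unconditional).**  A class-P flow with
`‖ω(τ,x)‖ ≤ M (−τ)^{−β}` on `(−∞,0) × ℝ³` for some `β > 1` is constant; `β = 1` is the scale-invariant (Type-I)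
vorticity rate.  Supersedes part 8's `const_of_vorticity_polynomial_decay` (`β > 4`).
[cite: MajdaBertozziCUP2002, §3.3 Prop. 3.8, (3.87)] [cite: KochNadirashviliSereginSverak2009, §4 (i) (arXiv:0709.3599)] -/
theorem const_of_vorticity_decay_gt_one
    {v : ℝ → EuclideanSpace ℝ (Fin 3) → EuclideanSpace ℝ (Fin 3)}
    (hc : ContinuousOn (uncurry v) (Iio 0 ×ˢ univ))
    (hK : ∃ K : ℝ, ∀ t < 0, ∀ x, ‖v t x‖ ≤ K)
    (hd : ∀ t < 0, IsWeaklyDivFree (v t))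
    (hm : ∀ s t : ℝ, s < t → t < 0 → ∀ x,
      v t x = heatExtension (v s) (t - s) x - oseenDuhamel 1 s v v t x)
    {β M : ℝ} (hβ : 1 < β)
    (hω : ∀ τ < 0, ∀ x : EuclideanSpace ℝ (Fin 3), ‖curl (v τ) x‖ ≤ M * (-τ) ^ (-β)) :
    ∃ b : EuclideanSpace ℝ (Fin 3), ∀ t < 0, ∀ x, v t x = b := by
  obtain ⟨hwc, hwK, hwd, hwm⟩ := TypeILiouvilleStrainLedger.classP_timeShift hc hK hd hm
    (T := -1) (by norm_num)
  have hwω : ∀ τ < 0, ∀ x : EuclideanSpace ℝ (Fin 3),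
      ‖curl ((fun t x => v (t + -1) x) τ) x‖ ≤ M * (1 - τ) ^ (-β) := by
    intro τ hτ x
    have h := hω (τ + -1) (by linarith) x
    rwa [show -(τ + -1) = 1 - τ by ring] at h
  obtain ⟨b, hb⟩ := const_of_vorticity_decay_gt_one_shifted hwc hwK hwd hwm hβ hwω
  have hb' : ∀ τ < -1, ∀ x, v τ x = b := fun τ hτ x => by
    simpa [show τ + 1 + -1 = τ by ring] using hb (τ + 1) (by linarith) x
  exact ⟨b, TypeILiouvilleStrainLedger.classP_const_of_const_below hc hK hm hb'⟩

/-! ## §4 Lamb curl fading faster than the scale-invariant rate ⟹ one constant vector -/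

/-- ★★ **`‖Dv[ω] − Dω[v]‖(τ,x) ≤ A (−τ)^{−p}`, `p > 2` ⟹ ONE CONSTANT VECTOR (unconditional).**  The Lamb-tail budget
(part 2) for the time-shifted flow gives `‖ω_w(t)‖ ≤ A (p−1)^{−1} (1−t)^{1−p}` (part 8's FTC value), and §3 applies with
`β = p − 1 > 1`; `p = 2` is the scale-invariant rate of `curl(v × ω)`.  Supersedes part 8 (`p > 5`).
[cite: KochNadirashviliSereginSverak2009, §4 (i), Lemma 6.1 (arXiv:0709.3599)] [cite: MajdaBertozziCUP2002, §3.3 (3.87), eq. (3.80)] -/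
theorem const_of_commutator_decay_gt_two
    {v : ℝ → EuclideanSpace ℝ (Fin 3) → EuclideanSpace ℝ (Fin 3)}
    (hc : ContinuousOn (uncurry v) (Iio 0 ×ˢ univ))
    (hK : ∃ K : ℝ, ∀ t < 0, ∀ x, ‖v t x‖ ≤ K)
    (hd : ∀ t < 0, IsWeaklyDivFree (v t))
    (hm : ∀ s t : ℝ, s < t → t < 0 → ∀ x,
      v t x = heatExtension (v s) (t - s) x - oseenDuhamel 1 s v v t x)
    {p A : ℝ} (hp : 2 < p)
    (hA : ∀ τ < 0, ∀ x : EuclideanSpace ℝ (Fin 3),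
      ‖fderiv ℝ (v τ) x (curl (v τ) x) - fderiv ℝ (curl (v τ)) x (v τ x)‖ ≤ A * (-τ) ^ (-p)) :
    ∃ b : EuclideanSpace ℝ (Fin 3), ∀ t < 0, ∀ x, v t x = b := by
  obtain ⟨hwc, hwK, hwd, hwm⟩ := TypeILiouvilleStrainLedger.classP_timeShift hc hK hd hm
    (T := -1) (by norm_num)
  set φ : ℝ → ℝ := fun τ => A * (max (1 - τ) 1) ^ (-p) with hφ_def
  have hφc : Continuous φ := continuous_const.mul (Continuous.rpow_const (by fun_prop) fun τ =>
    Or.inl (lt_of_lt_of_le one_pos (le_max_right _ _)).ne')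
  have hφ_eq : ∀ τ ≤ 0, φ τ = A * (1 - τ) ^ (-p) := fun τ hτ => by simp [hφ_def, max_eq_left (by linarith : (1 : ℝ) ≤ 1 - τ)]
  have hφ : ∀ τ < 0, ∀ x : EuclideanSpace ℝ (Fin 3),
      ‖fderiv ℝ ((fun t x => v (t + -1) x) τ) x (curl ((fun t x => v (t + -1) x) τ) x) -
        fderiv ℝ (curl ((fun t x => v (t + -1) x) τ)) x ((fun t x => v (t + -1) x) τ x)‖ ≤ φ τ := by
    intro τ hτ x
    have h := hA (τ + -1) (by linarith) x
    rw [show -(τ + -1) = 1 - τ by ring] at h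
    rwa [hφ_eq τ hτ.le]
  have hω : ∀ t < 0, ∀ x : EuclideanSpace ℝ (Fin 3),
      ‖curl ((fun t x => v (t + -1) x) t) x‖ ≤ A / (p - 1) * (1 - t) ^ (-(p - 1)) := by
    intro t ht x
    have hint : IntegrableOn φ (Iic t) := by
      have h : IntegrableOn (fun τ : ℝ => A * (1 - τ) ^ (-p)) (Iic t) :=
        (integrableOn_one_sub_rpow_neg_Iic_of_nonpos (q := p) (by linarith) ht.le).const_mul A
      exact IntegrableOn.congr_fun h (fun τ hτ => (hφ_eq τ ((mem_Iic.1 hτ).trans ht.le)).symm)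
        measurableSet_Iic
    have h := norm_curl_le_integral_Iic_of_commutator_majorant hwc hwK hwd hwm hφc hφ ht hint x
    have hval : ∫ τ in Iic t, φ τ = A * (1 - t) ^ (1 - p) / (p - 1) := by
      rw [← integral_Iic_one_sub_rpow_neg (q := p) (by linarith) ht.le A]
      exact setIntegral_congr_fun measurableSet_Iic fun τ hτ => hφ_eq τ ((mem_Iic.1 hτ).trans ht.le)
    calc ‖curl ((fun t x => v (t + -1) x) t) x‖ ≤ ∫ τ in Iic t, φ τ := h
      _ = A / (p - 1) * (1 - t) ^ (-(p - 1)) := by rw [hval, neg_sub]; ring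
  obtain ⟨b, hb⟩ := const_of_vorticity_decay_gt_one_shifted hwc hwK hwd hwm (β := p - 1) (by linarith) hω
  have hb' : ∀ τ < -1, ∀ x, v τ x = b := fun τ hτ x => by
    simpa [show τ + 1 + -1 = τ by ring] using hb (τ + 1) (by linarith) x
  exact ⟨b, TypeILiouvilleStrainLedger.classP_const_of_const_below hc hK hm hb'⟩

/-- The same with the hypothesis on the CURL OF THE LAMB VECTOR: `‖curl(v × curl v)(τ,x)‖ ≤ A (−τ)^{−p}` on
`(−∞,0) × ℝ³` for some `p > 2` ⟹ ONE CONSTANT VECTOR. [cite: MajdaBertozziCUP2002, §1.1, §2.3]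
[cite: KochNadirashviliSereginSverak2009, §4 (i) (arXiv:0709.3599)] -/
theorem const_of_lambCurl_decay_gt_two
    {v : ℝ → EuclideanSpace ℝ (Fin 3) → EuclideanSpace ℝ (Fin 3)}
    (hc : ContinuousOn (uncurry v) (Iio 0 ×ˢ univ))
    (hK : ∃ K : ℝ, ∀ t < 0, ∀ x, ‖v t x‖ ≤ K)
    (hd : ∀ t < 0, IsWeaklyDivFree (v t))
    (hm : ∀ s t : ℝ, s < t → t < 0 → ∀ x,
      v t x = heatExtension (v s) (t - s) x - oseenDuhamel 1 s v v t x)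
    {p A : ℝ} (hp : 2 < p)
    (hlamb : ∀ τ < 0, ∀ x : EuclideanSpace ℝ (Fin 3),
      ‖curl (fun y => cross (v τ y) (curl (v τ) y)) x‖ ≤ A * (-τ) ^ (-p)) :
    ∃ b : EuclideanSpace ℝ (Fin 3), ∀ t < 0, ∀ x, v t x = b := by
  obtain ⟨K, hKb⟩ := hK
  obtain ⟨hsm', -⟩ := smooth_and_bounds_of_bounded_ancient_oseenMild hc hd hm hKb
  have hsm : IsSmoothSpaceTimeOn (Iio 0) v := hsm'
  have hslice : ∀ τ < 0, ContDiff ℝ 2 (v τ) := fun τ hτ =>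
    (hsm.contDiff_slice (mem_Iio.2 hτ)).of_le (by norm_cast)
  have hdiv' : ∀ τ < 0, VectorCalculus.IsDivFree (v τ) := fun τ hτ =>
    (hd τ hτ).isDivFree_of_contDiff ((hslice τ hτ).of_le (by norm_num))
  refine const_of_commutator_decay_gt_two hc ⟨K, hKb⟩ hd hm (A := A) hp fun τ hτ x => ?_
  rw [← TypeILiouvilleGeneralizedBeltrami.curl_lamb_eq_sub (hslice τ hτ) (hdiv' τ hτ) x]
  exact hlamb τ hτ x

end Summit.NavierStokesRegularity.NavierStokesRegularity.Theorems.TypeILiouvilleLambTail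

end
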